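import Mathlib.Algebra.DualNumber
import Mathlib.Algebra.MvPolynomial.CommRing
import Summits.ResolutionOfSingularities.ResolutionOfSingularities.Theorems.WeightedInvariantHypersurfaceCentreAlgebraize
import HarnessLib

/-!
# The weighted centre filtration is NOT determined by the centre ideal and the weights (specimen)

Route `ResolutionOfSingularities/WeightedInvariant`, crux `Theses.WeightedInvariant.HypersurfaceCentreConstruction`
(stmt-ResolutionOfSingularities-19897), door line `local-engine`, CRUX-PLAN §v6.8 addenda 3–4 of
`res-L1-w43-plan-1` (design point (c9′) `LocalWeightedDropEFTCanonical`; ORDER (o10) to res-type-092):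
kernel documentation that the weighted filtration `weightedMonomialIdeal u w` (`I_n(u) = (u^α : Σ wᵢ αᵢ ≥ n)`,
Włodarczyk Lemma 2.1.12) depends on MORE than the ideal `(u₁, …, uₘ)` of the centre and the weight vector.

* NEGATIVE SPECIMEN (§2). In `k[X, Y] = MvPolynomial (Fin 2) k` (`k` any nontrivial commutative ring) with
  weights `(1, 2)`: the systems `u = (X, Y)` and `u'' = (X, Y + X)` generate the SAME ideal `(X, Y)`, but
  `I₂(X, Y) = (X², Y) ∋ Y` while `Y ∉ I₂(X, Y + X) = (X², Y + X)`; hence `I₂(u) ≠ I₂(u'')`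
  (`weightedMonomialIdeal_two_ne_shear`). Non-membership is certified by the `k`-algebra map
  `k[X, Y] → k[ε]`, `X ↦ ε`, `Y ↦ −ε` (dual numbers): it kills every generator of `I₂(X, Y + X)` (either a
  factor `Y + X ↦ 0` or a factor `X^a`, `a ≥ 2`, `↦ ε^a = 0`) but sends `Y` to `−ε ≠ 0` — the weight
  bookkeeping `wt ε = 1`, `ε² = 0`.
* POSITIVE TWIN (§1, any commutative ring). Perturbing the parameter of SMALLER weight by the one of larger (or
  equal) weight does not change the filtration: `I_n(x + c·y, y) = I_n(x, y)` for weights `a ≤ b` and all `n`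
  (`weightedMonomialIdeal_add_mul_left_eq`, from the jets lemma
  `weightedMonomialIdeal_eq_of_forall_sub_mem` of `WeightedInvariantHypersurfaceCentreAlgebraize`); in
  particular `I_n(X + Y, Y) = I_n(X, Y)` for weights `(1, 2)` (`weightedMonomialIdeal_add_left_eq_specimen`).
* §1 also computes the degree-`2` piece for weights `(1, 2)` in closed form: `I₂(x, y) = (x², y)`
  (`weightedMonomialIdeal_one_two_two_eq_span_pair`).

Consequence recorded for the door design (not a claim about Hironaka's problem): two closed points of one stratum
choosing weighted presentations `(u, w)` with the same centre ideal independently need not define the same Rees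
algebra; a canonical CENTRE FILTRATION (clause (c9′)), not merely a canonical centre, is what a global assembly
must posit. Def-free helper lemmas (`--supports stmt-ResolutionOfSingularities-19897`). AI-produced kernel
documentation; weaker than expert review.
-/

noncomputable section

set_option linter.dupNamespace false -- mandated namespace of this single-conjunct summit

namespace Summit.ResolutionOfSingularities.ResolutionOfSingularities.Theorems

open Literature.AlgebraicGeometry.Resolution

/-! ## §1 General commutative ring: closed form of `I₂` for weights `(1,2)`, and the positive twin -/

section General

variable {A : Type*} [CommRing A]

/-- **Closed form.** For two elements `x, y` with weights `(1, 2)`, the degree-`2` piece of the weighted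
filtration is `I₂(x, y) = (x², y)`: a monomial `x^a y^b` with `a + 2b ≥ 2` has `b ≥ 1` (divisible by `y`) or
`a ≥ 2` (divisible by `x²`), and conversely `x²` (`α = (2,0)`) and `y` (`α = (0,1)`) are generators.
[cite: Wlodarczyk2022, Lemma 2.1.12] -/
theorem weightedMonomialIdeal_one_two_two_eq_span_pair (x y : A) :
    weightedMonomialIdeal ![x, y] ![1, 2] 2 = Ideal.span {x ^ 2, y} := by
  apply le_antisymm
  · rw [weightedMonomialIdeal, Ideal.span_le]
    rintro _ ⟨α, hα, rfl⟩
    simp only [Fin.sum_univ_two, Fin.prod_univ_two, Matrix.cons_val_zero, Matrix.cons_val_one,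
      SetLike.mem_coe] at hα ⊢
    rw [Ideal.mem_span_pair]
    rcases Nat.eq_zero_or_pos (α 1) with h1 | h1
    · -- `b = 0`, so `a ≥ 2`: `x^a = x^(a-2) · x²`
      obtain ⟨c, hc⟩ : ∃ c, α 0 = c + 2 := ⟨α 0 - 2, by omega⟩
      exact ⟨x ^ c, 0, by rw [hc, h1, pow_zero, mul_one, pow_add, mul_comm, zero_mul, add_zero]⟩
    · -- `b ≥ 1`: `x^a y^b = (x^a y^(b-1)) · y`
      obtain ⟨c, hc⟩ : ∃ c, α 1 = c + 1 := ⟨α 1 - 1, by omega⟩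
      exact ⟨0, x ^ α 0 * y ^ c, by rw [hc, zero_mul, zero_add, mul_assoc, ← pow_succ]⟩
  · rw [Ideal.span_le, Set.insert_subset_iff, Set.singleton_subset_iff]
    refine ⟨?_, ?_⟩
    · -- `x² = u^(2,0)`
      have h := prod_pow_mem_weightedMonomialIdeal ![x, y] ![1, 2] (n := 2) ![2, 0]
        (by simp [Fin.sum_univ_two])
      simpa [Fin.prod_univ_two] using h
    · -- `y = u₁`, of weight `2`
      simpa using self_mem_weightedMonomialIdeal ![x, y] ![1, 2] 1

/-- **Positive twin, general form.** If the weights satisfy `a ≤ b`, replacing the weight-`a` parameter `x` by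
`x + c·y` (a perturbation by a multiple of the parameter `y` of weight `b ≥ a`, so `c·y ∈ I_a`) does not change
the weighted filtration: `I_n(x + c y, y) = I_n(x, y)` for every `n` (jets lemma
`weightedMonomialIdeal_eq_of_forall_sub_mem`). [cite: Wlodarczyk2022, Lemma 2.1.12] -/
theorem weightedMonomialIdeal_add_mul_left_eq (x y c : A) {a b : ℕ} (hab : a ≤ b) (n : ℕ) :
    weightedMonomialIdeal ![x + c * y, y] ![a, b] n = weightedMonomialIdeal ![x, y] ![a, b] n := by
  -- `y ∈ I_b(x, y) ⊆ I_a(x, y)` and `y ∈ I_b(x + c y, y) ⊆ I_a(x + c y, y)`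
  have hy : y ∈ weightedMonomialIdeal ![x, y] ![a, b] a :=
    weightedMonomialIdeal_antitone _ _ hab (by simpa using self_mem_weightedMonomialIdeal ![x, y] ![a, b] 1)
  have hy' : y ∈ weightedMonomialIdeal ![x + c * y, y] ![a, b] a :=
    weightedMonomialIdeal_antitone _ _ hab
      (by simpa using self_mem_weightedMonomialIdeal ![x + c * y, y] ![a, b] 1)
  refine weightedMonomialIdeal_eq_of_forall_sub_mem ![x, y] ![x + c * y, y] ![a, b]
    (Fin.forall_fin_two.2 ⟨?_, ?_⟩) (Fin.forall_fin_two.2 ⟨?_, ?_⟩) n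
  · simpa using Ideal.mul_mem_left _ c hy
  · simp
  · simpa using neg_mem (Ideal.mul_mem_left _ c hy')
  · simp

/-- **Positive twin** (the case `c = 1`): `I_n(x + y, y) = I_n(x, y)` for weights `a ≤ b` and all `n`.
[cite: Wlodarczyk2022, Lemma 2.1.12] -/
theorem weightedMonomialIdeal_add_left_eq (x y : A) {a b : ℕ} (hab : a ≤ b) (n : ℕ) :
    weightedMonomialIdeal ![x + y, y] ![a, b] n = weightedMonomialIdeal ![x, y] ![a, b] n := by
  simpa using weightedMonomialIdeal_add_mul_left_eq x y 1 hab n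

/-- The sheared system `(x, y + x)` generates the same ideal as `(x, y)` (same centre). [folklore] -/
theorem span_range_shear_eq_span_range (x y : A) :
    Ideal.span (Set.range ![x, y + x]) = Ideal.span (Set.range ![x, y]) := by
  rw [Matrix.range_cons_cons_empty, Matrix.range_cons_cons_empty]
  apply le_antisymm
  · rw [Ideal.span_le, Set.insert_subset_iff, Set.singleton_subset_iff]
    exact ⟨Ideal.subset_span (by simp), Ideal.mem_span_pair.2 ⟨1, 1, by ring⟩⟩
  · rw [Ideal.span_le, Set.insert_subset_iff, Set.singleton_subset_iff]
    exact ⟨Ideal.subset_span (by simp), Ideal.mem_span_pair.2 ⟨-1, 1, by ring⟩⟩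

/-- The perturbed system `(x + y, y)` generates the same ideal as `(x, y)` (same centre). [folklore] -/
theorem span_range_add_left_eq_span_range (x y : A) :
    Ideal.span (Set.range ![x + y, y]) = Ideal.span (Set.range ![x, y]) := by
  rw [Matrix.range_cons_cons_empty, Matrix.range_cons_cons_empty]
  apply le_antisymm
  · rw [Ideal.span_le, Set.insert_subset_iff, Set.singleton_subset_iff]
    exact ⟨Ideal.mem_span_pair.2 ⟨1, 1, by ring⟩, Ideal.subset_span (by simp)⟩
  · rw [Ideal.span_le, Set.insert_subset_iff, Set.singleton_subset_iff]
    exact ⟨Ideal.mem_span_pair.2 ⟨1, -1, by ring⟩, Ideal.subset_span (by simp)⟩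

end General

/-! ## §2 The specimen in `k[X, Y]`: `I₂(X, Y) ≠ I₂(X, Y + X)` for weights `(1, 2)` -/

section Specimen

open MvPolynomial TrivSqZeroExt
open scoped DualNumber

variable (k : Type*) [CommRing k]

/-- `Y ∈ I₂(X, Y)` for weights `(1, 2)` (`Y` is the parameter of weight `2`). [cite: Wlodarczyk2022, Lemma 2.1.12] -/
theorem X_one_mem_weightedMonomialIdeal_one_two :
    (X 1 : MvPolynomial (Fin 2) k) ∈ weightedMonomialIdeal ![(X 0 : MvPolynomial (Fin 2) k), X 1] ![1, 2] 2 := by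
  simpa using self_mem_weightedMonomialIdeal ![(X 0 : MvPolynomial (Fin 2) k), X 1] ![1, 2] 1

/-- The `k`-algebra map `k[X, Y] → k[ε]`, `X ↦ ε`, `Y ↦ −ε`, into the dual numbers kills the whole piece
`I₂(X, Y + X)` (weights `(1, 2)`): a generator `X^a (Y + X)^b` with `a + 2b ≥ 2` has a factor `Y + X ↦ 0`
(`b ≥ 1`) or a factor `X^a ↦ ε^a = 0` (`a ≥ 2`). [folklore] -/
theorem weightedMonomialIdeal_shear_le_ker_aeval_dualNumber :
    weightedMonomialIdeal ![(X 0 : MvPolynomial (Fin 2) k), X 1 + X 0] ![1, 2] 2 ≤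
      RingHom.ker (MvPolynomial.aeval ![(DualNumber.eps : k[ε]), -DualNumber.eps] :
        MvPolynomial (Fin 2) k →ₐ[k] k[ε]) := by
  rw [weightedMonomialIdeal, Ideal.span_le]
  rintro _ ⟨α, hα, rfl⟩
  simp only [Fin.sum_univ_two, Fin.prod_univ_two, Matrix.cons_val_zero, Matrix.cons_val_one,
    SetLike.mem_coe, RingHom.mem_ker] at hα ⊢
  rw [map_mul, map_pow, map_pow, map_add, MvPolynomial.aeval_X, MvPolynomial.aeval_X]
  simp only [Matrix.cons_val_zero, Matrix.cons_val_one, neg_add_cancel]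
  rcases Nat.eq_zero_or_pos (α 1) with h1 | h1
  · -- `b = 0` forces `a ≥ 2`, and `ε^a = ε^(a-2) ε² = 0`
    obtain ⟨c, hc⟩ : ∃ c, α 0 = c + 2 := ⟨α 0 - 2, by omega⟩
    rw [hc, h1, pow_zero, mul_one, pow_add, DualNumber.eps_pow_two, mul_zero]
  · rw [zero_pow h1.ne', mul_zero]

variable [Nontrivial k]

/-- `Y ∉ I₂(X, Y + X)` for weights `(1, 2)` over any nontrivial commutative ring `k`: the dual-number
evaluation `X ↦ ε, Y ↦ −ε` kills `I₂(X, Y + X)` but `Y ↦ −ε ≠ 0`. [folklore] -/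
theorem X_one_not_mem_weightedMonomialIdeal_shear :
    (X 1 : MvPolynomial (Fin 2) k) ∉ weightedMonomialIdeal ![(X 0 : MvPolynomial (Fin 2) k), X 1 + X 0] ![1, 2] 2 := by
  intro h
  have h' := weightedMonomialIdeal_shear_le_ker_aeval_dualNumber k h
  rw [RingHom.mem_ker] at h'
  have h'' : (-(DualNumber.eps : k[ε])).snd = (0 : k[ε]).snd := by
    rw [← h']
    simp
  simp at h''

/-- **NEGATIVE SPECIMEN.** In `k[X, Y]` with weights `(1, 2)` the systems `(X, Y)` and `(X, Y + X)` — which generate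
the same ideal `(X, Y)` (`span_range_shear_eq_span_range`) — have DIFFERENT degree-`2` pieces:
`I₂(X, Y) = (X², Y) ≠ (X², Y + X) = I₂(X, Y + X)` (witness: `Y`). So the weighted centre filtration / Rees
algebra is not a function of the centre ideal and the weights alone. [folklore] -/
theorem weightedMonomialIdeal_two_ne_shear :
    weightedMonomialIdeal ![(X 0 : MvPolynomial (Fin 2) k), X 1] ![1, 2] 2 ≠
      weightedMonomialIdeal ![(X 0 : MvPolynomial (Fin 2) k), X 1 + X 0] ![1, 2] 2 := fun h =>
  X_one_not_mem_weightedMonomialIdeal_shear k (h ▸ X_one_mem_weightedMonomialIdeal_one_two k)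

omit [Nontrivial k] in
/-- **POSITIVE TWIN (specimen).** In `k[X, Y]` with weights `(1, 2)`: `I_n(X + Y, Y) = I_n(X, Y)` for every `n`
(a weight-`≥` substitution preserves the filtration). [cite: Wlodarczyk2022, Lemma 2.1.12] -/
theorem weightedMonomialIdeal_add_left_eq_specimen (n : ℕ) :
    weightedMonomialIdeal ![(X 0 : MvPolynomial (Fin 2) k) + X 1, X 1] ![1, 2] n =
      weightedMonomialIdeal ![(X 0 : MvPolynomial (Fin 2) k), X 1] ![1, 2] n :=
  weightedMonomialIdeal_add_left_eq (X 0) (X 1) (by norm_num) n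

/-- **Packaged design point (c9′).** There are two parameter systems of `k[X, Y]` generating the SAME ideal, and one
vector of POSITIVE weights, whose weighted filtrations differ already in degree `2`: the centre ideal together with
the weights does not determine the centre filtration. [folklore] -/
theorem exists_weightedMonomialIdeal_ne_of_span_range_eq :
    ∃ (u v : Fin 2 → MvPolynomial (Fin 2) k) (w : Fin 2 → ℕ),
      Ideal.span (Set.range u) = Ideal.span (Set.range v) ∧ (∀ i, 0 < w i) ∧
        weightedMonomialIdeal u w 2 ≠ weightedMonomialIdeal v w 2 :=
  ⟨![X 0, X 1], ![X 0, X 1 + X 0], ![1, 2], (span_range_shear_eq_span_range (X 0) (X 1)).symm,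
    Fin.forall_fin_two.2 ⟨by norm_num, by norm_num⟩, weightedMonomialIdeal_two_ne_shear k⟩

end Specimen

/-! ## §3 Any number of parameters: elementary transvections by a parameter of weight `≥` preserve the filtration -/

section Transvection

variable {A : Type*} [CommRing A] {m : ℕ}

/-- **Weight-`≥` transvections preserve the weighted filtration** (general form of the positive twin, any number
of parameters). If `i ≠ j` and `wᵢ ≤ wⱼ`, replacing the parameter `uᵢ` by `uᵢ + c·uⱼ` (any `c ∈ A`) changes no
piece of the weighted filtration: `I_n(u₁, …, uᵢ + c uⱼ, …, uₘ) = I_n(u)` for all `n` — the perturbation `c uⱼ`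
lies in `I_{wⱼ}(u) ⊆ I_{wᵢ}(u)`, and symmetrically for the inverse transvection (jets lemma
`weightedMonomialIdeal_eq_of_forall_sub_mem`). Statement shape adapted from res-type-078's (o10) draft
(HOME/plan/tools/res-type-078/o10/, sha16 90a376fc50f53b4e). [cite: Wlodarczyk2022, Lemma 2.1.12] -/
theorem weightedMonomialIdeal_update_add_mul_eq (u : Fin m → A) (w : Fin m → ℕ) {i j : Fin m} (hij : i ≠ j)
    (hw : w i ≤ w j) (c : A) (n : ℕ) :
    weightedMonomialIdeal (Function.update u i (u i + c * u j)) w n = weightedMonomialIdeal u w n := by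
  have hj : Function.update u i (u i + c * u j) j = u j := Function.update_of_ne hij.symm _ _
  refine weightedMonomialIdeal_eq_of_forall_sub_mem u _ w (fun l => ?_) (fun l => ?_) n
  · by_cases hl : l = i
    · subst hl
      rw [Function.update_self, add_sub_cancel_left]
      exact Ideal.mul_mem_left _ _
        (weightedMonomialIdeal_antitone u w hw (self_mem_weightedMonomialIdeal u w j))
    · rw [Function.update_of_ne hl, sub_self]
      exact Ideal.zero_mem _
  · by_cases hl : l = i
    · subst hl
      rw [Function.update_self, sub_add_cancel_left]
      have h := self_mem_weightedMonomialIdeal (Function.update u l (u l + c * u j)) w j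
      rw [hj] at h
      exact neg_mem (Ideal.mul_mem_left _ _ (weightedMonomialIdeal_antitone _ w hw h))
    · rw [Function.update_of_ne hl, sub_self]
      exact Ideal.zero_mem _

/-- **The specimen in transvection form.** The OPPOSITE transvection — adding the weight-`1` parameter to the
weight-`2` one, `u₁ ↦ u₁ + u₀` for `u = (X, Y)`, `w = (1, 2)` in `k[X, Y]` — DOES change the filtration (degree-`2`
piece), although it is an automorphism of the centre ideal `(X, Y)`: the hypothesis `wᵢ ≤ wⱼ` of
`weightedMonomialIdeal_update_add_mul_eq` cannot be dropped. [folklore] -/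
theorem weightedMonomialIdeal_update_ne_of_weight_lt (k : Type*) [CommRing k] [Nontrivial k] :
    weightedMonomialIdeal (Function.update ![(MvPolynomial.X 0 : MvPolynomial (Fin 2) k), MvPolynomial.X 1] 1
        (MvPolynomial.X 1 + 1 * MvPolynomial.X 0)) ![1, 2] 2 ≠
      weightedMonomialIdeal ![(MvPolynomial.X 0 : MvPolynomial (Fin 2) k), MvPolynomial.X 1] ![1, 2] 2 := by
  have hu : Function.update ![(MvPolynomial.X 0 : MvPolynomial (Fin 2) k), MvPolynomial.X 1] 1
      (MvPolynomial.X 1 + 1 * MvPolynomial.X 0) = ![MvPolynomial.X 0, MvPolynomial.X 1 + MvPolynomial.X 0] := by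
    funext l
    fin_cases l <;> simp
  rw [hu]
  exact (weightedMonomialIdeal_two_ne_shear k).symm

end Transvection

end Summit.ResolutionOfSingularities.ResolutionOfSingularities.Theorems

end
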